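import Summits.QuantumFields.YangMills.Theorems.UnitScaleTiltHalvingEffGaugeTowerRatio
import HarnessLib

/-!
# Line H (`BirthV10.stub_halvingStep`, stmt-QuantumFields-19200) — (M2′) (b)-row: ★★ (B-al-4)₂-LOCAL — THE PYRAMID INDUCTION WITH THE `U1` ROWS ON THE PYRAMID ONLY

Cell `ym3-torus` (HUMAN RULING D-0037: YM₃ on T³ is ladder rung R3 — NOT d = 4, NOT infinite volume, NOT a mass gap, NOT the Clay problem), width seat
`ym-ust-20520-w3` gen 9 (LEAD-H ★w5-19200 g7 WORD 21: «(B-al-4) = w3-20520 g9»).  `--supports stmt-QuantumFields-19200 --as helper`; THEOREMS ONLY (0 `def`, 0 `sorry`);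
count-neutral; nothing here claims B-al-2, (B-al-4)₃, (M2′), the stub, the crux or the gap.

WHY.  ✓p692310 `norm_effGaugeStep_mul_eml_sub_one_le` asks `∀ x, u x ∈ U1` and ✓p694594 `norm_effGauge_ratio_le_of_pyramid` asks `κ j x, A j x ∈ U1` for ALL `j, x` and the
stair transporters of `U̿^{(j)}X` to be `U1`-valued EVERYWHERE.  The application ((B-al-4)₃, the door's row `hG`) has unitarity only ON THE PYRAMID under the top cube (the
`exp[mean log]` of a far-from-`1` unitary family need not be unitary).  This file re-proves both with the `U1` rows restricted to the pyramid: the one step depends on the gauge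
only at the block centre and the centre-stair ends (✓`coe_vframeU_gaugeActT_eq_conj_eml`), so the global lemma applies to the gauge MODIFIED to `1` off the block; the induction
then runs verbatim, CARRYING the gauge's membership in a caller-chosen class `G ⊆ U1` (unitarity, for matrices) by a caller-supplied one-step transfer `hκsG` — the
effective gauge is unitary on the pyramid only BECAUSE its block oscillation is small there, which is what the induction itself produces.  Rows `hh e τ E`, `hS`, `hE` VERBATIM.
HONEST SCOPE.  Bookkeeping re-proof; no new analysis.

References: T. Bałaban, CMP **98** (1985) 17–51 [Balaban1985Averaging] ((97)–(100) p.32, (110) p.34); CMP **109** (1987) 249–301 [Balaban1987RG1] ((0.4)–(0.8) p.253).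
-/

set_option autoImplicit false

noncomputable section

open scoped BigOperators
open NormedSpace Metric Set

namespace Summit.QuantumFields.YangMills.Theorems.HalvingEffGaugeTowerRatioLocal

open Literature.MathematicalPhysics.QuantumFieldTheory.Balaban1983to89
open T4Continuum BlockAveraging ExpMeanLog MatrixLog
open B10Eq27TorusAxialLog (holT gaugeActT gaugeActT_apply)
open Summit.QuantumFields.YangMills.Theorems.Prop8ChartDoubleBar (vframeU coe_vframeU dbarIterU)
open Summit.QuantumFields.YangMills.Theorems.HalvingEffGaugeStepBlockMean (norm_effGaugeStep_mul_eml_sub_one_le coe_vframeU_gaugeActT_eq_conj_eml)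
open Summit.QuantumFields.YangMills.Theorems.HalvingEffGaugeTowerRatio (norm_ratio_step_le norm_osc_of_ratio)
open B7Prop1Explicit (U1 mem_U1)

variable {P : Params} {𝔸 : Type*} [NormedRing 𝔸] [NormedAlgebra ℂ 𝔸] [CompleteSpace 𝔸] [NormOneClass 𝔸]

/-! ## §1 The one step with the gauge `U1`-valued on the block only -/

/-- ★ **(B-al-4)₁ LOCALISED**: ✓`norm_effGaugeStep_mul_eml_sub_one_le` with `u ∈ U1` asked only at the block centre `ŷ` and the centre-stair ends `x_i` (the step reads `u`
nowhere else, ✓`coe_vframeU_gaugeActT_eq_conj_eml`). [cite: Balaban1985Averaging, (110) p.34, (97)-(100) p.32; Balaban1987RG1, (0.5)-(0.8) p.253] -/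
theorem norm_effGaugeStep_mul_eml_sub_one_le_local {j : ℕ} (u : GaugeTransf P j 𝔸ˣ) (W : GaugeField P j 𝔸ˣ) (y : Site P (j + 1))
    (huc : u (emb y) ∈ U1 𝔸) (hui : ∀ i : Idx P, u (walkEnd (emb y) (stairWord i.2.1 (off i.1))) ∈ U1 𝔸)
    (hH : ∀ i : Idx P, holT W (emb y) (stairWord i.2.1 (off i.1)) ∈ U1 𝔸) {h e : ℝ} (h0 : 0 ≤ h) (e0 : 0 ≤ e)
    (hh : ∀ i : Idx P, ‖((holT W (emb y) (stairWord i.2.1 (off i.1)) : 𝔸ˣ) : 𝔸) - 1‖ ≤ h)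
    (he : ∀ i : Idx P, ‖((((u (walkEnd (emb y) (stairWord i.2.1 (off i.1))))⁻¹ * u (emb y)) : 𝔸ˣ) : 𝔸) - 1‖ ≤ e)
    (hh0 : h ≤ 1 / 64) (he0 : e ≤ 1 / 64) :
    ‖(((u (emb y))⁻¹ * ((vframeU (gaugeActT u W) y)⁻¹ * u (emb y) * vframeU W y) : 𝔸ˣ) : 𝔸) *
        eml (fun i : Idx P => ((((u (walkEnd (emb y) (stairWord i.2.1 (off i.1))))⁻¹ * u (emb y)) : 𝔸ˣ) : 𝔸)) - 1‖ ≤ 1536 * h * e := by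
  classical
  obtain ⟨T, hT⟩ : ∃ T : Set (Site P j), T = insert (emb y) (Set.range fun i : Idx P => walkEnd (emb y) (stairWord i.2.1 (off i.1))) := ⟨_, rfl⟩
  obtain ⟨u', hu'⟩ : ∃ u' : GaugeTransf P j 𝔸ˣ, u' = fun x => if x ∈ T then u x else 1 := ⟨_, rfl⟩
  have hc : u' (emb y) = u (emb y) := by rw [hu']; exact if_pos (hT ▸ Set.mem_insert _ _)
  have hi : ∀ i : Idx P, u' (walkEnd (emb y) (stairWord i.2.1 (off i.1))) = u (walkEnd (emb y) (stairWord i.2.1 (off i.1))) :=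
    fun i => by rw [hu']; exact if_pos (hT ▸ Set.mem_insert_of_mem _ ⟨i, rfl⟩)
  have hU : ∀ x, u' x ∈ U1 𝔸 := by
    intro x
    by_cases hx : x ∈ T
    · have hx' := hx
      rw [hT] at hx'
      rcases hx' with hx' | ⟨i, hx'⟩
      · rw [hx', hc]; exact huc
      · rw [← hx', hi]; exact hui i
    · rw [hu']; simp only [if_neg hx]; exact (U1 𝔸).one_mem
  have hv : vframeU (gaugeActT u' W) y = vframeU (gaugeActT u W) y := by
    apply Units.ext
    rw [coe_vframeU_gaugeActT_eq_conj_eml, coe_vframeU_gaugeActT_eq_conj_eml, hc]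
    simp only [hi]
  have hmain := norm_effGaugeStep_mul_eml_sub_one_le u' W y hU hH h0 e0 hh (fun i => by rw [hi, hc]; exact he i) hh0 he0
  simp only [hc, hi, hv] at hmain
  exact hmain

/-! ## §2 The k-step induction with the `U1` rows on the pyramid, the gauge's unitarity carried along -/

/-- ★★ **(B-al-4)₂ LOCALISED — THE k-STEP JOINT INDUCTION ON THE PYRAMID.**  As ✓`HalvingEffGaugeTowerRatio.norm_effGauge_ratio_le_of_pyramid` (rows `hh e τ E`, closure
`hS`, level recursion `hE` VERBATIM) but: the reference's `U1` row and the stair transporters' `U1` row are asked ON THE PYRAMID only (`hAU`, `hHU`), and the effective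
gauge's membership in a caller-chosen class `G ⊆ U1` (for `M₂(ℂ)`: the unitary units) is CARRIED ALONG the induction from `hκ0G` (level `0` on `S 0`) by the caller's
one-step transfer `hκsG` (which may use the block oscillation bound `e j + 2.1·E j` the induction has just produced).  Conclusion: on the pyramid, `κ j x ∈ G` AND
`‖κ_j(x)·A_j(x)⁻¹ − 1‖ ≤ E j`. [cite: Balaban1985Averaging, (97)-(100) p.32, (110) p.34; Balaban1987RG1, (0.5)-(0.8) p.253] -/
theorem norm_effGauge_ratio_le_of_pyramid_local (X : GaugeField P 0 𝔸ˣ)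
    (κ A : (j : ℕ) → GaugeTransf P j 𝔸ˣ)
    (hκs : ∀ (j : ℕ) (y : Site P (j + 1)),
      κ (j + 1) y = (vframeU (gaugeActT (κ j) (dbarIterU j X)) y)⁻¹ * κ j (emb y) * vframeU (dbarIterU j X) y)
    {k : ℕ} (S : (j : ℕ) → Set (Site P j))
    (hS : ∀ j, j < k → ∀ y ∈ S (j + 1), emb y ∈ S j ∧ ∀ i : Idx P, walkEnd (emb y) (stairWord i.2.1 (off i.1)) ∈ S j)
    (G : Set 𝔸ˣ) (hGU : ∀ u ∈ G, u ∈ U1 𝔸)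
    (hAU : ∀ j, j ≤ k → ∀ x ∈ S j, A j x ∈ U1 𝔸)
    (hHU : ∀ j, j < k → ∀ y ∈ S (j + 1), ∀ i : Idx P, holT (dbarIterU j X) (emb y) (stairWord i.2.1 (off i.1)) ∈ U1 𝔸)
    (hh e τ E : ℕ → ℝ)
    (hh0 : ∀ j, 0 ≤ hh j) (hh1 : ∀ j, hh j ≤ 1 / 64) (he0 : ∀ j, 0 ≤ e j) (he1 : ∀ j, e j ≤ 1 / 200) (hτ1 : ∀ j, τ j ≤ 1 / 10)
    (hE1 : ∀ j, j ≤ k → E j ≤ 1 / 200)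
    (hH : ∀ j, j < k → ∀ y ∈ S (j + 1), ∀ i : Idx P,
      ‖((holT (dbarIterU j X) (emb y) (stairWord i.2.1 (off i.1)) : 𝔸ˣ) : 𝔸) - 1‖ ≤ hh j)
    (hosc : ∀ j, j < k → ∀ y ∈ S (j + 1), ∀ i : Idx P,
      ‖(((A j (emb y))⁻¹ * A j (walkEnd (emb y) (stairWord i.2.1 (off i.1))) : 𝔸ˣ) : 𝔸) - 1‖ ≤ e j)
    (href : ∀ j, j < k → ∀ y ∈ S (j + 1),
      ‖(((A (j + 1) y)⁻¹ * A j (emb y) : 𝔸ˣ) : 𝔸) *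
          eml (fun i : Idx P => (((A j (emb y))⁻¹ * A j (walkEnd (emb y) (stairWord i.2.1 (off i.1))) : 𝔸ˣ) : 𝔸)) - 1‖ ≤ τ j)
    (hκ0G : ∀ x ∈ S 0, κ 0 x ∈ G)
    (hκsG : ∀ j, j < k → ∀ y ∈ S (j + 1), κ j (emb y) ∈ G → (∀ i : Idx P, κ j (walkEnd (emb y) (stairWord i.2.1 (off i.1))) ∈ G) →
      (∀ i : Idx P, ‖((((κ j (walkEnd (emb y) (stairWord i.2.1 (off i.1))))⁻¹ * κ j (emb y)) : 𝔸ˣ) : 𝔸) - 1‖ ≤ e j + 21 / 10 * E j) →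
      κ (j + 1) y ∈ G)
    (hinit : ∀ x ∈ S 0, ‖((κ 0 x : 𝔸ˣ) : 𝔸) * (((A 0 x)⁻¹ : 𝔸ˣ) : 𝔸) - 1‖ ≤ E 0)
    (hE : ∀ j, j < k →
      E j + 160 * E j ^ 2 + 3300 * E j * e j + 5 * (1536 * hh j * (e j + 21 / 10 * E j)) + 4 * τ j ≤ E (j + 1)) :
    ∀ j, j ≤ k → ∀ x ∈ S j, κ j x ∈ G ∧ ‖((κ j x : 𝔸ˣ) : 𝔸) * (((A j x)⁻¹ : 𝔸ˣ) : 𝔸) - 1‖ ≤ E j := by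
  intro j
  induction j with
  | zero => intro _ x hx; exact ⟨hκ0G x hx, hinit x hx⟩
  | succ j ih =>
    intro hjk y hy
    have hj : j < k := Nat.lt_of_succ_le hjk
    have ihj := ih hj.le
    obtain ⟨hemb, hends⟩ := hS j hj y hy
    have hκcG := (ihj _ hemb).1
    have hκiG := fun i : Idx P => (ihj _ (hends i)).1
    have hκc := hGU _ hκcG
    have hκi := fun i : Idx P => hGU _ (hκiG i)
    have hAc := hAU j hj.le _ hemb
    have hAi := fun i : Idx P => hAU j hj.le _ (hends i)
    have hEj0 : 0 ≤ E j := (norm_nonneg _).trans (ihj _ hemb).2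
    have hEj1 : E j ≤ 1 / 100 := (hE1 j hj.le).trans (by norm_num)
    have hoscκ : ∀ i : Idx P,
        ‖((((κ j (walkEnd (emb y) (stairWord i.2.1 (off i.1))))⁻¹ * κ j (emb y)) : 𝔸ˣ) : 𝔸) - 1‖ ≤ e j + 21 / 10 * E j :=
      fun i => norm_osc_of_ratio hAc (hκi i) (hAi i) (ihj _ hemb).2 (ihj _ (hends i)).2
        (by have h := hosc j hj y hy i; rwa [Units.val_mul] at h)
    refine ⟨hκsG j hj y hy hκcG hκiG hoscκ, ?_⟩
    have hr₁ := norm_effGaugeStep_mul_eml_sub_one_le_local (κ j) (dbarIterU j X) y hκc hκi (hHU j hj y hy)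
      (hh0 j) (by have := he0 j; positivity) (hH j hj y hy) hoscκ (hh1 j) (by have := he1 j; have := hE1 j hj.le; linarith)
    rw [← hκs j y, Units.val_mul] at hr₁
    have hstep := norm_ratio_step_le (ι := Idx P) (κ j (emb y)) (A j (emb y)) (κ (j + 1) y) (A (j + 1) y)
      (fun i => κ j (walkEnd (emb y) (stairWord i.2.1 (off i.1)))) (fun i => A j (walkEnd (emb y) (stairWord i.2.1 (off i.1))))
      hκc hAc hκi hAi hEj1 (he0 j) ((he1 j).trans (by norm_num))
      (by have := hh0 j; have := he0 j; positivity) (hτ1 j)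
      (ihj _ hemb).2 (fun i => (ihj _ (hends i)).2) (fun i => by have h := hosc j hj y hy i; rwa [Units.val_mul] at h) hr₁
      (by have h := href j hj y hy; rwa [Units.val_mul] at h)
    exact hstep.trans (hE j hj)

end Summit.QuantumFields.YangMills.Theorems.HalvingEffGaugeTowerRatioLocal

end
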